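import Mathlib.Combinatorics.SimpleGraph.Clique
import Mathlib.Analysis.SpecialFunctions.Pow.Real
import Mathlib.Algebra.Order.BigOperators.Ring.Finset
import HarnessLib

/-!
# Planted clique: top-`k` selection from an approximate indicator, and the clean-up step

Two deterministic combinatorial steps of the Alon–Krivelevich–Sudakov algorithm (AKS 1998, §2.2,
last two paragraphs of the analysis of Algorithm A), isolated from probability and from linear
algebra:

* `card_sdiff_le_of_top_selection` — **selection**: if a real vector `z` on the vertex set is
  close in `ℓ²` to the normalised indicator `e = 1_T/√k` of a `k`-set `T`,
  `Σᵢ (zᵢ - eᵢ)² ≤ θ²`, and `W` is any `k`-set of coordinates dominating its complement in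
  absolute value (`|z j| ≤ |z i|` for `i ∈ W`, `j ∉ W` — what "the `k` largest coordinates" means,
  ties broken arbitrarily), then `|W \ T| = |T \ W| ≤ 9 k θ²` (AKS: "at least `5k/6` of the `k`
  largest coordinates … correspond to vertices of the clique").
* `filter_threeQuarters_eq` — **clean-up**: if `T` is a `k`-clique (`k ≥ 12`), `W` a set with
  `|W \ T|, |T \ W| ≤ k/6`, and every vertex outside `T` has fewer than `7k/12` neighbours in `T`,
  then the vertices with at least `3k/4` neighbours in `W` (integer test `3k ≤ 4 · #`) are exactly
  the vertices of `T` (AKS: "each vertex not in the clique has at most `(1+o(1))k/2 + k/6 < 3k/4`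
  neighbors in `W`", and clique vertices have `≥ 5k/6 - 1`).

## References

* N. Alon, M. Krivelevich, B. Sudakov, *Finding a large hidden clique in a random graph*, Random
  Structures Algorithms 13 (1998) 457–466, §2.1 (Algorithm A, step 2) and §2.2 (end of the
  analysis) [AlonKrivelevichSudakov1998].
-/

noncomputable section

open Finset

namespace Literature.Probability.RandomGraphs.PlantedClique

variable {V : Type*} [Fintype V] [DecidableEq V]

/-! ### Selection of the `k` largest coordinates -/

omit [DecidableEq V] in
/-- Markov-type count: the coordinates where `z` deviates from `e` by at least `δ > 0` number at
most `(Σ (zᵢ - eᵢ)²)/δ²`. [folklore] -/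
theorem card_filter_le_abs_sub_le (z e : V → ℝ) {δ : ℝ} (hδ : 0 < δ) :
    (((univ : Finset V).filter fun i => δ ≤ |z i - e i|).card : ℝ) * δ ^ 2 ≤
      ∑ i, (z i - e i) ^ 2 := by
  calc (((univ : Finset V).filter fun i => δ ≤ |z i - e i|).card : ℝ) * δ ^ 2
      = ∑ _i ∈ (univ : Finset V).filter (fun i => δ ≤ |z i - e i|), δ ^ 2 := by
        rw [sum_const, nsmul_eq_mul]
    _ ≤ ∑ i ∈ (univ : Finset V).filter (fun i => δ ≤ |z i - e i|), (z i - e i) ^ 2 := by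
        refine sum_le_sum fun i hi => ?_
        have h := (mem_filter.1 hi).2
        rw [← sq_abs (z i - e i)]
        exact pow_le_pow_left₀ hδ.le h 2
    _ ≤ ∑ i, (z i - e i) ^ 2 :=
        sum_le_sum_of_subset_of_nonneg (filter_subset _ _) fun i _ _ => sq_nonneg _

/-- **Selection** (AKS 1998, §2.2): let `T` be a `k`-set (`k ≥ 1`), `e = 1_T/√k`, and `z` a real
vector with `Σᵢ (zᵢ - eᵢ)² ≤ θ²`. If `W` is a `k`-set whose coordinates dominate those outside it
in absolute value, then `|W \ T| ≤ 9kθ²` and `|T \ W| ≤ 9kθ²`.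
[cite: AlonKrivelevichSudakov1998, §2.2 (analysis of Algorithm A, `|W ∩ {1,…,k}| ≥ 5k/6`)] -/
theorem card_sdiff_le_of_top_selection {k : ℕ} (hk : 1 ≤ k) {T W : Finset V} (hT : T.card = k)
    (hW : W.card = k) (z : V → ℝ) {θ : ℝ}
    (hz : ∑ i, (z i - if i ∈ T then 1 / Real.sqrt k else 0) ^ 2 ≤ θ ^ 2)
    (htop : ∀ i ∈ W, ∀ j ∉ W, |z j| ≤ |z i|) :
    ((W \ T).card : ℝ) ≤ 9 * k * θ ^ 2 ∧ ((T \ W).card : ℝ) ≤ 9 * k * θ ^ 2 := by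
  set e : V → ℝ := fun i => if i ∈ T then 1 / Real.sqrt k else 0 with he
  have hk0 : (0 : ℝ) < k := by exact_mod_cast hk
  have hsq : 0 < Real.sqrt k := Real.sqrt_pos.2 hk0
  set δ : ℝ := 1 / (3 * Real.sqrt k) with hδ
  have hδ0 : 0 < δ := by positivity
  set Bad := (univ : Finset V).filter fun i => δ ≤ |z i - e i| with hBad
  -- `#Bad ≤ 9 k θ²`
  have hBadcard : (Bad.card : ℝ) ≤ 9 * k * θ ^ 2 := by
    have h := card_filter_le_abs_sub_le z e hδ0
    have hδ2 : δ ^ 2 = 1 / (9 * k) := by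
      rw [hδ, div_pow, mul_pow, Real.sq_sqrt hk0.le]; norm_num
    rw [← hBad, hδ2] at h
    have h' : (Bad.card : ℝ) ≤ 9 * k * ∑ i, (z i - e i) ^ 2 := by
      rw [mul_one_div, div_le_iff₀ (by positivity)] at h
      linarith
    exact h'.trans (by gcongr)
  -- `|T \ W| = |W \ T|`
  have hcardeq : (T \ W).card = (W \ T).card := by
    have h1 := card_sdiff_add_card_inter T W
    have h2 := card_sdiff_add_card_inter W T
    rw [inter_comm] at h2
    omega
  -- the pigeonhole step
  have hmain : (T \ W).card ≤ Bad.card := by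
    by_contra hlt
    push Not at hlt
    -- a good vertex of `T` outside `W`
    obtain ⟨i, hi, hiBad⟩ : ∃ i ∈ T \ W, i ∉ Bad := by
      by_contra hnone
      push Not at hnone
      exact absurd (card_le_card fun x hx => hnone x hx) (not_le.2 hlt)
    -- a good vertex of `W` outside `T`
    obtain ⟨j, hj, hjBad⟩ : ∃ j ∈ W \ T, j ∉ Bad := by
      by_contra hnone
      push Not at hnone
      have := card_le_card (fun x hx => hnone x hx : W \ T ⊆ Bad)
      omega
    rw [mem_sdiff] at hi hj
    have hiBad' : |z i - e i| < δ := by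
      by_contra hge; exact hiBad (mem_filter.2 ⟨mem_univ _, not_lt.1 hge⟩)
    have hjBad' : |z j - e j| < δ := by
      by_contra hge; exact hjBad (mem_filter.2 ⟨mem_univ _, not_lt.1 hge⟩)
    have hei : e i = 1 / Real.sqrt k := by simp [he, hi.1]
    have hej : e j = 0 := by simp [he, hj.2]
    rw [hei] at hiBad'
    rw [hej, sub_zero] at hjBad'
    -- `|z i| > 2δ`, `|z j| < δ`, contradicting the domination `|z i| ≤ |z j|`
    have hdom := htop j hj.1 i hi.2
    have h3δ : 1 / Real.sqrt k = 3 * δ := by rw [hδ]; field_simp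
    rw [h3δ] at hiBad'
    have : 3 * δ - |z i| ≤ |z i - 3 * δ| := by
      rw [abs_sub_comm]
      calc 3 * δ - |z i| = |3 * δ| - |z i| := by
            rw [abs_of_pos (mul_pos (by norm_num : (0 : ℝ) < 3) hδ0)]
        _ ≤ |3 * δ - z i| := abs_sub_abs_le_abs_sub _ _
    linarith
  refine ⟨?_, ?_⟩
  · rw [← hcardeq]; exact le_trans (by exact_mod_cast hmain) hBadcard
  · exact le_trans (by exact_mod_cast hmain) hBadcard

/-! ### The clean-up step -/

/-- **Clean-up** (AKS 1998, Algorithm A, step 2 and the end of §2.2): let `T` be a clique with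
`|T| = k ≥ 12`, `W` a vertex set with `|W \ T| ≤ k/6` and `|T \ W| ≤ k/6`, and suppose every vertex
outside `T` has fewer than `7k/12` neighbours in `T`. Then the vertices with at least `3k/4`
neighbours in `W` are exactly the vertices of `T`.
[cite: AlonKrivelevichSudakov1998, §2.2 (end of the analysis of Algorithm A)] -/
theorem filter_threeQuarters_eq (G : SimpleGraph V) [DecidableRel G.Adj] {k : ℕ} (hk : 12 ≤ k)
    {T W : Finset V} (hT : T.card = k) (hclique : G.IsClique (T : Set V))
    (hWT : ((W \ T).card : ℝ) ≤ k / 6) (hTW : ((T \ W).card : ℝ) ≤ k / 6)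
    (hdeg : ∀ v, v ∉ T → ((T.filter fun w => G.Adj v w).card : ℝ) < 7 * k / 12) :
    ((univ : Finset V).filter fun v => 3 * k ≤ 4 * (W.filter fun w => G.Adj v w).card) = T := by
  ext v
  simp only [mem_filter, mem_univ, true_and]
  constructor
  · -- vertices passing the test are in `T`
    intro hv
    by_contra hvT
    have hsub : (W.filter fun w => G.Adj v w) ⊆ (T.filter fun w => G.Adj v w) ∪ (W \ T) := by
      intro w hw
      rw [mem_filter] at hw
      by_cases hwT : w ∈ T
      · exact mem_union_left _ (mem_filter.2 ⟨hwT, hw.2⟩)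
      · exact mem_union_right _ (mem_sdiff.2 ⟨hw.1, hwT⟩)
    have hcard : ((W.filter fun w => G.Adj v w).card : ℝ) < 7 * k / 12 + k / 6 := by
      calc ((W.filter fun w => G.Adj v w).card : ℝ)
          ≤ (((T.filter fun w => G.Adj v w) ∪ (W \ T)).card : ℝ) := by
            exact_mod_cast card_le_card hsub
        _ ≤ ((T.filter fun w => G.Adj v w).card : ℝ) + ((W \ T).card : ℝ) := by
            exact_mod_cast card_union_le _ _
        _ < 7 * k / 12 + k / 6 := add_lt_add_of_lt_of_le (hdeg v hvT) hWT
    have hv' : (3 * k : ℝ) ≤ 4 * ((W.filter fun w => G.Adj v w).card : ℝ) := by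
      exact_mod_cast hv
    linarith
  · -- vertices of `T` pass the test
    intro hvT
    have hsub : (W ∩ T).erase v ⊆ W.filter fun w => G.Adj v w := by
      intro w hw
      rw [mem_erase, mem_inter] at hw
      exact mem_filter.2 ⟨hw.2.1, hclique hvT hw.2.2 (Ne.symm hw.1)⟩
    have h1 : ((W ∩ T).card : ℝ) ≥ k - k / 6 := by
      have h := card_sdiff_add_card_inter T W
      rw [inter_comm] at h
      have h' : ((T \ W).card : ℝ) + ((W ∩ T).card : ℝ) = k := by rw [← hT]; exact_mod_cast h
      linarith
    have h2 : (((W ∩ T).erase v).card : ℝ) ≥ k - k / 6 - 1 := by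
      have h := card_erase_le (s := W ∩ T) (a := v)
      have h' := pred_card_le_card_erase (s := W ∩ T) (a := v)
      have : (((W ∩ T).erase v).card : ℝ) ≥ ((W ∩ T).card : ℝ) - 1 := by
        have := Nat.sub_le_iff_le_add.1 h'
        have : ((W ∩ T).card : ℝ) ≤ (((W ∩ T).erase v).card : ℝ) + 1 := by exact_mod_cast this
        linarith
      linarith
    have h3 : (((W ∩ T).erase v).card : ℝ) ≤ ((W.filter fun w => G.Adj v w).card : ℝ) := by
      exact_mod_cast card_le_card hsub
    have hk' : (12 : ℝ) ≤ k := by exact_mod_cast hk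
    have : (3 * k : ℝ) ≤ 4 * ((W.filter fun w => G.Adj v w).card : ℝ) := by linarith
    exact_mod_cast this

end Literature.Probability.RandomGraphs.PlantedClique

end
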